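import Summits.NavierStokesRegularity.NavierStokesRegularity.Theorems.TypeIIInviscidRelaxationAxisymSwirlRegularZhangBarrierRiccati
import HarnessLib

/-!
# An explicit half-line barrier for the drift `c/√(T−t)` (Zhang 2026, κ = 1), II: the similarity profile

Helper toward the crux `AxisymSwirlRegular` (stmt-NavierStokesRegularity-1964, route TypeIIInviscidRelaxation),
registered line `radial_inflow_split`, criterion side `stub_oneSidedRadialCriterion` (⟨19059⟩); continuation of
`…ZhangBarrierRiccati` (see its module docstring for the construction and its purpose: the barrier hypothesis of
`RadialInflowComparisonT.zhang2026_partialTypeI_of_barrier`, i.e. Zhang's Thm 1.1 by name).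

THIS FILE: the similarity profile `F = prof c = u·v` (`u = 1 − e^{−λξ}(1+λξ)`, `λ = c+1`; `v = exp(m ψ)`,
`ψ = −(A/c)e^{−cξ} + 2 arsinh(ξ−2c)`, `ψ′ = φ`), its first two derivatives in closed form (`dprof`, `ddprof`,
`hasDerivAt_prof`, `hasDerivAt_dprof`), smoothness, and **the supersolution inequality**
`F″ + (c − 1/ξ − ξ/2)F′ + mF ≤ 0` on `(0,∞)` (`profile_ineq`), through the identity
`F″ + pF′ + mF = v·[(c−λ−ξ/2+2mφ)u′ + m u (φ′ + pφ + mφ² + 1)]` and `riccati_le`; also `F(0) = 0`, `F ≥ 0`,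
`F′ ≥ 0` and monotonicity on `[0,∞)`.  Under `w(r,t) = Λ(T−t)^m F(r/√(T−t))` the barrier inequality
`w_rr − w_r/r + (c/√(T−t))w_r ≤ w_t` is exactly `profile_ineq` at `ξ = r/√(T−t)`.

Pure Mathlib real analysis; no NS statement here.
References: Qi S. Zhang, arXiv:2604.07785 (2026), §2 [Zhang2026PartialTypeI].
-/

noncomputable section

set_option linter.dupNamespace false

open Set Filter Topology Real

namespace Summit.NavierStokesRegularity.NavierStokesRegularity.Theorems.ZhangBarrier

/-! ## §2 The profile `F = u · v` and its derivatives -/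

/-- The inner rate `λ = c + 1`. [new] -/
def lam (c : ℝ) : ℝ := c + 1

/-- Inner layer `u(ξ) = 1 − e^{−λξ}(1+λξ)`, the exact solution of `u″ + (λ − 1/ξ)u′ = 0` with `u(0)=0`. [new] -/
def uu (c ξ : ℝ) : ℝ := 1 - exp (-(lam c * ξ)) * (1 + lam c * ξ)

/-- `u′(ξ) = λ² ξ e^{−λξ}`. [new] -/
def duu (c ξ : ℝ) : ℝ := lam c ^ 2 * ξ * exp (-(lam c * ξ))

/-- `u″(ξ) = λ² e^{−λξ}(1 − λξ)`. [new] -/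
def dduu (c ξ : ℝ) : ℝ := lam c ^ 2 * exp (-(lam c * ξ)) * (1 - lam c * ξ)

/-- `ψ(ξ) = −(A/c) e^{−cξ} + 2 arsinh(ξ − 2c)`, an antiderivative of `φ`. [new] -/
def psi (c ξ : ℝ) : ℝ := -(bigA c / c) * exp (-(c * ξ)) + 2 * arsinh (ξ - 2 * c)

/-- Outer factor `v = exp(m ψ)`. [new] -/
def vv (c ξ : ℝ) : ℝ := exp (expo c * psi c ξ)

/-- `v′ = m φ v`. [new] -/
def dvv (c ξ : ℝ) : ℝ := expo c * phi c ξ * vv c ξ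

/-- `v″ = m v (φ′ + m φ²)`. [new] -/
def ddvv (c ξ : ℝ) : ℝ := expo c * vv c ξ * (dphi c ξ + expo c * phi c ξ ^ 2)

/-- **The similarity profile** `F = u·v`. [new] -/
def prof (c ξ : ℝ) : ℝ := uu c ξ * vv c ξ

/-- `F′ = u′v + uv′`. [new] -/
def dprof (c ξ : ℝ) : ℝ := duu c ξ * vv c ξ + uu c ξ * dvv c ξ

/-- `F″ = u″v + 2u′v′ + uv″`. [new] -/
def ddprof (c ξ : ℝ) : ℝ := dduu c ξ * vv c ξ + 2 * duu c ξ * dvv c ξ + uu c ξ * ddvv c ξ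

/-- `λ > 0`. -/
theorem lam_pos {c : ℝ} (hc : 0 < c) : 0 < lam c := by unfold lam; linarith

/-- `v > 0`. -/
theorem vv_pos (c ξ : ℝ) : 0 < vv c ξ := exp_pos _

/-- Derivative of `x ↦ e^{−ax}`. -/
private theorem hasDerivAt_expneg (a ξ : ℝ) :
    HasDerivAt (fun x => exp (-(a * x))) (exp (-(a * ξ)) * (-a)) ξ := by
  have h : HasDerivAt (fun x => -(a * x)) (-(a * 1)) ξ := ((hasDerivAt_id' ξ).const_mul a).neg
  exact h.exp.congr_deriv (by ring)

/-- `u′ = duu`. -/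
theorem hasDerivAt_uu (c ξ : ℝ) : HasDerivAt (uu c) (duu c ξ) ξ := by
  have h1 := hasDerivAt_expneg (lam c) ξ
  have h2 : HasDerivAt (fun x => 1 + lam c * x) (lam c * 1) ξ :=
    ((hasDerivAt_id' ξ).const_mul (lam c)).const_add 1
  have h : HasDerivAt (fun x => 1 - exp (-(lam c * x)) * (1 + lam c * x))
      (0 - (exp (-(lam c * ξ)) * (-lam c) * (1 + lam c * ξ) + exp (-(lam c * ξ)) * (lam c * 1))) ξ :=
    (hasDerivAt_const ξ (1 : ℝ)).sub (h1.mul h2)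
  refine h.congr_deriv ?_
  simp only [duu]; ring

/-- `u″ = dduu`. -/
theorem hasDerivAt_duu (c ξ : ℝ) : HasDerivAt (duu c) (dduu c ξ) ξ := by
  have h1 := hasDerivAt_expneg (lam c) ξ
  have h2 : HasDerivAt (fun x => lam c ^ 2 * x) (lam c ^ 2 * 1) ξ := (hasDerivAt_id' ξ).const_mul _
  have h : HasDerivAt (fun x => lam c ^ 2 * x * exp (-(lam c * x)))
      (lam c ^ 2 * 1 * exp (-(lam c * ξ)) + lam c ^ 2 * ξ * (exp (-(lam c * ξ)) * (-lam c))) ξ :=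
    h2.mul h1
  refine h.congr_deriv ?_
  simp only [dduu]; ring

/-- `ψ′ = φ` (`c ≠ 0`). -/
theorem hasDerivAt_psi {c : ℝ} (hc : c ≠ 0) (ξ : ℝ) : HasDerivAt (psi c) (phi c ξ) ξ := by
  have h1 := (hasDerivAt_expneg c ξ).const_mul (-(bigA c / c))
  have h2 : HasDerivAt (fun x => x - 2 * c) 1 ξ := (hasDerivAt_id' ξ).sub_const _
  have h3 := h2.arsinh.const_mul 2
  have h : HasDerivAt (fun x => -(bigA c / c) * exp (-(c * x)) + 2 * arsinh (x - 2 * c))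
      (-(bigA c / c) * (exp (-(c * ξ)) * (-c)) + 2 * ((√(1 + (ξ - 2 * c) ^ 2))⁻¹ • (1 : ℝ))) ξ :=
    h1.add h3
  refine h.congr_deriv ?_
  simp only [phi, smul_eq_mul, mul_one]
  field_simp

/-- `φ′ = dphi`. -/
theorem hasDerivAt_phi (c ξ : ℝ) : HasDerivAt (phi c) (dphi c ξ) ξ := by
  have h1 := (hasDerivAt_expneg c ξ).const_mul (bigA c)
  have hpos : 1 + (ξ - 2 * c) ^ 2 ≠ 0 := by positivity
  have hsq : √(1 + (ξ - 2 * c) ^ 2) ≠ 0 := by positivity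
  have h2 : HasDerivAt (fun x => 1 + (x - 2 * c) ^ 2) (((2 : ℕ) : ℝ) * (ξ - 2 * c) ^ (2 - 1) * 1) ξ :=
    (((hasDerivAt_id' ξ).sub_const (2 * c)).pow 2).const_add 1
  have h3 := h2.sqrt hpos
  have h4 := (hasDerivAt_const ξ (2 : ℝ)).fun_div h3 hsq
  have h : HasDerivAt (fun x => bigA c * exp (-(c * x)) + 2 / √(1 + (x - 2 * c) ^ 2))
      (bigA c * (exp (-(c * ξ)) * (-c))
        + (0 * √(1 + (ξ - 2 * c) ^ 2) - 2 * (((2 : ℕ) : ℝ) * (ξ - 2 * c) ^ (2 - 1) * 1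
            / (2 * √(1 + (ξ - 2 * c) ^ 2)))) / √(1 + (ξ - 2 * c) ^ 2) ^ 2) ξ :=
    h1.add h4
  refine h.congr_deriv ?_
  simp only [dphi]
  norm_num
  field_simp
  ring

/-- `v′ = dvv`. -/
theorem hasDerivAt_vv {c : ℝ} (hc : c ≠ 0) (ξ : ℝ) : HasDerivAt (vv c) (dvv c ξ) ξ := by
  have h : HasDerivAt (fun x => exp (expo c * psi c x)) (exp (expo c * psi c ξ) * (expo c * phi c ξ)) ξ :=
    ((hasDerivAt_psi hc ξ).const_mul (expo c)).exp
  refine h.congr_deriv ?_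
  simp only [dvv, vv]; ring

/-- `(v′)′ = ddvv`. -/
theorem hasDerivAt_dvv {c : ℝ} (hc : c ≠ 0) (ξ : ℝ) : HasDerivAt (dvv c) (ddvv c ξ) ξ := by
  have h : HasDerivAt (fun x => expo c * phi c x * vv c x)
      (expo c * dphi c ξ * vv c ξ + expo c * phi c ξ * dvv c ξ) ξ :=
    ((hasDerivAt_phi c ξ).const_mul (expo c)).mul (hasDerivAt_vv hc ξ)
  refine h.congr_deriv ?_
  simp only [ddvv, dvv]; ring

/-- `F′ = dprof`. -/
theorem hasDerivAt_prof {c : ℝ} (hc : c ≠ 0) (ξ : ℝ) : HasDerivAt (prof c) (dprof c ξ) ξ := by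
  have h : HasDerivAt (fun x => uu c x * vv c x) (duu c ξ * vv c ξ + uu c ξ * dvv c ξ) ξ :=
    (hasDerivAt_uu c ξ).mul (hasDerivAt_vv hc ξ)
  exact h

/-- `(F′)′ = ddprof`. -/
theorem hasDerivAt_dprof {c : ℝ} (hc : c ≠ 0) (ξ : ℝ) : HasDerivAt (dprof c) (ddprof c ξ) ξ := by
  have h : HasDerivAt (fun x => duu c x * vv c x + uu c x * dvv c x)
      (dduu c ξ * vv c ξ + duu c ξ * dvv c ξ + (duu c ξ * dvv c ξ + uu c ξ * ddvv c ξ)) ξ :=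
    ((hasDerivAt_duu c ξ).mul (hasDerivAt_vv hc ξ)).add ((hasDerivAt_uu c ξ).mul (hasDerivAt_dvv hc ξ))
  refine h.congr_deriv ?_
  simp only [ddprof]; ring

/-- `deriv F = dprof`. -/
theorem deriv_prof {c : ℝ} (hc : c ≠ 0) : deriv (prof c) = dprof c :=
  funext fun ξ => (hasDerivAt_prof hc ξ).deriv

/-- `deriv F′ = ddprof`. -/
theorem deriv_dprof {c : ℝ} (hc : c ≠ 0) : deriv (dprof c) = ddprof c :=
  funext fun ξ => (hasDerivAt_dprof hc ξ).deriv

/-- `F` is smooth on `ℝ`. -/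
theorem contDiff_prof (c : ℝ) {n : WithTop ℕ∞} : ContDiff ℝ n (prof c) := by
  have h1 : ContDiff ℝ n (uu c) := by
    unfold uu; fun_prop
  have h2 : ContDiff ℝ n (psi c) := by
    unfold psi
    have ha : ContDiff ℝ n (fun x : ℝ => arsinh (x - 2 * c)) :=
      contDiff_arsinh.comp (contDiff_id.sub contDiff_const)
    fun_prop
  have h3 : ContDiff ℝ n (vv c) := by unfold vv; fun_prop
  unfold prof; fun_prop

/-- `F` is continuous. -/
theorem continuous_prof (c : ℝ) : Continuous (prof c) := (contDiff_prof c (n := 0)).continuous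

/-! ## §3 The supersolution inequality for the profile -/

/-- `u ≥ 0` (from `1 + x ≤ e^x`). -/
theorem uu_nonneg (c ξ : ℝ) : 0 ≤ uu c ξ := by
  unfold uu
  have h1 : 1 + lam c * ξ ≤ exp (lam c * ξ) := by
    have := add_one_le_exp (lam c * ξ); linarith
  have h2 : exp (-(lam c * ξ)) * (1 + lam c * ξ) ≤ exp (-(lam c * ξ)) * exp (lam c * ξ) :=
    mul_le_mul_of_nonneg_left h1 (exp_pos _).le
  rw [← exp_add, neg_add_cancel, exp_zero] at h2
  linarith

/-- `u′ ≥ 0` on `[0,∞)`. -/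
theorem duu_nonneg (c : ℝ) {ξ : ℝ} (hξ : 0 ≤ ξ) : 0 ≤ duu c ξ := by
  unfold duu; positivity

/-- **The profile is a supersolution:** `F″ + (c − 1/ξ − ξ/2)F′ + mF ≤ 0` on `(0,∞)`.  The identity
`F″ + pF′ + mF = v[(c−λ−ξ/2+2mφ)u′ + m u (φ′ + pφ + mφ² + 1)]` (`p = c − 1/ξ − ξ/2`, using
`u″ + (λ−1/ξ)u′ = 0`), then `2mφ ≤ 2m(A+2) = 1/8 < 1 = λ − c`, `u′ ≥ 0`, `u ≥ 0` and `riccati_le`. [new] -/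
theorem profile_ineq {c : ℝ} (hc : 0 < c) {ξ : ℝ} (hξ : 0 < ξ) :
    ddprof c ξ + (c - ξ⁻¹ - ξ / 2) * dprof c ξ + expo c * prof c ξ ≤ 0 := by
  have hone : ξ⁻¹ * ξ = 1 := inv_mul_cancel₀ hξ.ne'
  have key : ddprof c ξ + (c - ξ⁻¹ - ξ / 2) * dprof c ξ + expo c * prof c ξ
      = vv c ξ * ((c - lam c - ξ / 2 + 2 * expo c * phi c ξ) * duu c ξ
        + expo c * uu c ξ * (dphi c ξ + (c - ξ⁻¹ - ξ / 2) * phi c ξ + expo c * phi c ξ ^ 2 + 1)) := by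
    unfold ddprof dprof prof ddvv dvv dduu duu
    linear_combination (-(vv c ξ) * lam c ^ 2 * exp (-(lam c * ξ)) * uu c ξ * 0
      - vv c ξ * lam c ^ 2 * exp (-(lam c * ξ))) * hone
  rw [key]
  have hv := vv_pos c ξ
  have hR := riccati_le hc hξ
  have hu := uu_nonneg c ξ
  have hu' := duu_nonneg c hξ.le
  have hm := expo_pos c
  have hφ : 2 * expo c * phi c ξ ≤ 1 / 8 := by
    have h1 := phi_le c ξ hc hξ.le
    have h2 := expo_mul c
    have h3 : 2 * expo c * phi c ξ ≤ 2 * expo c * (bigA c + 2) :=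
      mul_le_mul_of_nonneg_left h1 (by positivity)
    nlinarith
  have hcoef : c - lam c - ξ / 2 + 2 * expo c * phi c ξ ≤ 0 := by unfold lam; linarith
  have t1 : (c - lam c - ξ / 2 + 2 * expo c * phi c ξ) * duu c ξ ≤ 0 :=
    mul_nonpos_of_nonpos_of_nonneg hcoef hu'
  have t2 : expo c * uu c ξ * (dphi c ξ + (c - ξ⁻¹ - ξ / 2) * phi c ξ + expo c * phi c ξ ^ 2 + 1) ≤ 0 :=
    mul_nonpos_of_nonneg_of_nonpos (by positivity) (by linarith)
  exact mul_nonpos_of_nonneg_of_nonpos hv.le (by linarith)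

/-- `F′ ≥ 0` on `[0,∞)`. -/
theorem dprof_nonneg (c : ℝ) {ξ : ℝ} (hξ : 0 ≤ ξ) : 0 ≤ dprof c ξ := by
  unfold dprof dvv
  have := vv_pos c ξ
  have := uu_nonneg c ξ
  have := duu_nonneg c hξ
  have := phi_pos c ξ
  have := expo_pos c
  positivity

/-- `F` is nondecreasing on `[0,∞)`. -/
theorem monotoneOn_prof {c : ℝ} (hc : 0 < c) : MonotoneOn (prof c) (Ici 0) := by
  refine monotoneOn_of_deriv_nonneg (convex_Ici 0) (continuous_prof c).continuousOn
    (fun x _ => (hasDerivAt_prof hc.ne' x).differentiableAt.differentiableWithinAt) ?_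
  intro x hx
  rw [interior_Ici] at hx
  rw [(hasDerivAt_prof hc.ne' x).deriv]
  exact dprof_nonneg c (le_of_lt hx)

/-- `F(0) = 0`. -/
theorem prof_zero (c : ℝ) : prof c 0 = 0 := by simp [prof, uu]

/-- `F ≥ 0` on `[0,∞)`. -/
theorem prof_nonneg (c ξ : ℝ) : 0 ≤ prof c ξ :=
  mul_nonneg (uu_nonneg c ξ) (vv_pos c ξ).le

end Summit.NavierStokesRegularity.NavierStokesRegularity.Theorems.ZhangBarrier

end
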